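import Summits.QuantumFields.YangMills.Theorems.BalabanUVNodesN15KingModelGraphTreeDecayContinuumLimit

/-!
# BalabanUVNodes ∕ N15 — THE KING-MODEL RUNG (PART Β-f₁): THE VACUUM ENERGY DENSITY OF A DIAGRAM CONVERGES AS `K → ∞` WITH RATE AND BOUND INDEPENDENT OF THE VOLUME
# — THEOREM 2.1 (ii) (2.23)'s CONTENT `|ln Z(T)| ≤ C|T|` FOR ONE DIAGRAM OF KING's `A = 0` MODEL, BY NAME (part Β-a ∕ Β-d divided by `|T^{(K)}| = (2L^{e_M})^{d+1}`)
# (Track A, DAG node N15 = NE2; FAN-OUT v1.1 §N15 s3 «KING-MODEL RUNG … NE2's analogue DECIDED in the model»)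

HONEST FRAMING.  Count-neutral (cell `pub-ymgap`, seat `pub-ymgap-dag-n15-e` g30; `--supports stmt-QuantumFields-27366 --as helper` = K3⁸
`SpineGivenEndpointR13SepCoPHV`).  TEMPLATE LITERATURE: C. King, *The U(1) Higgs model. I. The continuum limit*, Commun. Math. Phys. **102** (1986) 649–677
[King1986]: Theorem 2.1 (2.22)–(2.23) p. 654 and (3.13) p. 657 («The uniform bound in Theorem 2.1 is just the statement of ultra-violet stability») — run on ONE VACUUM
DIAGRAM of KING's OWN `A = 0` MODEL: the density `e_K(G) = E^{(K+1)}(G)∕|T^{(K)}|` (part Β-d's `kingVacuumSeq` over part Β-a's `card_unitTorus`).  NOT `ln Z`, NOT Bałaban's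
`G(U)`, NOT a node discharge; nothing continuum-ℝ⁴ ∕ OS ∕ mass-gap ∕ Clay.  0 `sorry`; standard axioms; one plumbing `def` (the density).  Pages re-read 2026-08-29.

THE PRINT.  p. 654 [PDF 6] (2.23): *«|ln Z(T, g, h)| ≤ C|T|, where C depends on g, h and |T| = Π_{μ=1}^d 2L_μ»*; p. 657 (3.13): *«Hence {Z^{ε_κ}} is a Cauchy sequence and
converges to a unique limit as κ → ∞. The uniform bound in Theorem 2.1 is just the statement of ultra-violet stability.»*

READING (declared; ours).  The VACUUM ENERGY DENSITY `e_K(G) = E^{(K+1)}(G)∕|T^{(K)}|` of a connected vacuum diagram has consecutive differences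
`≤ (L^{−γ}A^{2m+nn+1}m!(m+1))(L^{−γ})^K` (part Β-d `kingVacuumSeq_succ_sub_le` divided by `|T| = (2L^{e_M})^{d+1}`) and sizes `≤ A^{m+nn+1}Σ_π degConst` (part Β-a
`king_vacuum_graph_size_extensive` divided by `|T|`) with NO VOLUME FACTOR: ★★★ its limit `e_∞(G)` exists with `|e_K − e_∞| ≤ C r^K∕(1−r)` and `|e_∞| ≤ A^{m+nn+1}Σ_π degConst`,
ALL CONSTANTS INDEPENDENT OF `e_M` — (2.23)'s content (a bounded energy density, uniformly in the torus) for one diagram; §2: NO hypothesis for connected pseudoforests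
of `G`-lines in `1 ≤ d ≤ 3`.

WHAT THIS FILE PROVES (namespace `Summit.QuantumFields.YangMills.BalabanUVNodes.N15KingModelRung.Curved`).  §1 `kingVacuumDensity`, ★ `kingVacuumDensity_succ_sub_le`,
★ `kingVacuumDensity_abs_le`, ★★★ **`king_vacuum_density_continuumLimit`**.  §2 ★★ `king_vacuum_pseudoforest_density_continuumLimit`.

HONEST SCOPE.  (a) One diagram of King's `A = 0` model; p. 664's sentence and (3.77) along every ordering are the hypotheses (both discharged in §2); the vertices'
couplings, sources, dressings and §3.5 are not placed (part Β-a HONEST SCOPE (a)).  (b) NOT Bałaban's `G(U)`; N15 untouched; counts unmoved.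
Locators: [King1986] Thm 2.1 (2.22)–(2.23) p.654, (3.13) p.657, Thm 3.4 (3.9) p.656, Prop. 3.6 (3.56) p.662, p.664, (3.77) p.666.
-/

noncomputable section

open scoped BigOperators Topology
open Finset Filter

namespace Summit.QuantumFields.YangMills.BalabanUVNodes.N15KingModelRung.Curved

open Literature.MathematicalPhysics.QuantumFieldTheory.Balaban1983to89.B5Prop11Plancherel (Tor fine)
open Summit.QuantumFields.YangMills.BalabanUVNodes.N15KingModelRung (KingVolIndex kingVol kingVol_neZero)
open Summit.QuantumFields.YangMills.BalabanUVNodes.N15KingModelRung.Graph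

variable {d : ℕ} (L : ℕ) [NeZero L]

/-! ## §1–§2 The vacuum energy density of a diagram: limit and bound, uniformly in the volume; the hypothesis-free class -/

section Density

/-- **THE VACUUM ENERGY DENSITY ALONG `K`**: `e_K(G) = E^{(K+1)}(G)∕|T^{(K)}|`, `|T^{(K)}| = (2L^{e_M})^{d+1}`. [cite: King1986, Thm 2.1 (ii) (2.23) p.654 («|ln Z| ≤ C|T|»)] -/
def kingVacuumDensity (a msq : ℝ) (eM nn m : ℕ) (src tgt : Fin m → Fin (nn + 1)) (κ : Fin m → Option (Fin (d + 1))) (K : ℕ) : ℝ :=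
  kingVacuumSeq L a msq eM nn m src tgt κ K / (2 * (L : ℝ) ^ eM) ^ (d + 1)

/-- ★ **CONSECUTIVE DIFFERENCES OF THE DENSITY: GEOMETRIC AND VOLUME-FREE**: with part Β-d's `(A, γ)`, under p. 664's sentence,
`|e_{K+1}(G) − e_K(G)| ≤ (L^{−γ}·A^{2m+nn+1}·m!·(m+1))·(L^{−γ})^K`. [cite: King1986, Thm 3.4 (3.9) p.656, Thm 2.1 (2.23) p.654] -/
theorem kingVacuumDensity_succ_sub_le (hLodd : Odd L) (hL : 2 ≤ L) {a : ℝ} (ha : 0 < a) {m0sq : ℝ} (hm0 : 0 ≤ m0sq) :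
    ∃ A γ : ℝ, 1 ≤ A ∧ 0 < γ ∧ ∀ (msq : ℝ), 0 < msq → msq ≤ m0sq → ∀ (eM nn m : ℕ) (src tgt : Fin m → Fin (nn + 1)), (∀ v, LConn src tgt univ 0 v) →
      ∀ (κ : Fin m → Option (Fin (d + 1))), PosSubgraphsBy src tgt 0 ((d + 1 : ℕ) : ℝ) (fun ℓ => lineExp (d + 1) (κ ℓ)) →
      ∀ K : ℕ, |kingVacuumDensity L a msq eM nn m src tgt κ (K + 1) - kingVacuumDensity L a msq eM nn m src tgt κ K|
        ≤ ((L : ℝ) ^ (-γ) * (A ^ (2 * m + nn + 1) * ((m.factorial : ℝ) * (m + 1)))) * ((L : ℝ) ^ (-γ)) ^ K := by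
  obtain ⟨A, γ, hA, hγ, H⟩ := kingVacuumSeq_succ_sub_le (d := d) L hLodd hL ha hm0
  refine ⟨A, γ, hA, hγ, fun msq hm hcap eM nn m src tgt hconn κ hsub K => ?_⟩
  have hL0 : (0 : ℝ) < L := by exact_mod_cast (show 0 < L by omega)
  have hT : (0 : ℝ) < (2 * (L : ℝ) ^ eM) ^ (d + 1) := by positivity
  have key := H msq hm hcap eM nn m src tgt hconn κ hsub K
  unfold kingVacuumDensity
  rw [← sub_div, abs_div, abs_of_pos hT, div_le_iff₀ hT]
  calc _ ≤ _ := key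
    _ = _ := by ring

/-- ★ **THE DENSITY IS BOUNDED VOLUME-FREE, UNIFORMLY IN `K`**: with part Β-a's size constant, under (3.77) along every ordering,
`|e_K(G)| ≤ A^{m+nn+1}·Σ_π degConst`. [cite: King1986, Thm 2.1 (ii) (2.23) p.654, (3.77) p.666] -/
theorem kingVacuumDensity_abs_le (hLodd : Odd L) (hL : 2 ≤ L) {a : ℝ} (ha : 0 < a) {m0sq : ℝ} (hm0 : 0 ≤ m0sq) :
    ∃ A : ℝ, 1 ≤ A ∧ ∀ (msq : ℝ), 0 < msq → msq ≤ m0sq → ∀ (eM nn m : ℕ) (src tgt : Fin m → Fin (nn + 1)), (∀ v, LConn src tgt univ 0 v) →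
      ∀ (κ : Fin m → Option (Fin (d + 1))),
      (∀ π : Equiv.Perm (Fin m), PosDegrees (kingDegList src tgt ((d + 1 : ℕ) : ℝ) (fun ℓ => lineExp (d + 1) (κ ℓ)) π)) →
      ∀ K : ℕ, |kingVacuumDensity L a msq eM nn m src tgt κ K|
        ≤ A ^ (m + nn + 1) * ∑ π : Equiv.Perm (Fin m), degConst L (kingDegList src tgt ((d + 1 : ℕ) : ℝ) (fun ℓ => lineExp (d + 1) (κ ℓ)) π) := by
  obtain ⟨A, hA, H⟩ := king_vacuum_graph_size_extensive (d := d) L hLodd hL ha hm0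
  refine ⟨A, hA, fun msq hm hcap eM nn m src tgt hconn κ hking K => ?_⟩
  have hL0 : (0 : ℝ) < L := by exact_mod_cast (show 0 < L by omega)
  have hT : (0 : ℝ) < (2 * (L : ℝ) ^ eM) ^ (d + 1) := by positivity
  have key := H msq hm hcap (jvSucc (d := d) eM K) nn m src tgt hconn κ hking
  haveI := kingVol_neZero L (jvSucc (d := d) eM K)
  have hcard : (Fintype.card (Tor (kingVol L (jvSucc (d := d) eM K))) : ℝ) = (2 * (L : ℝ) ^ eM) ^ (d + 1) := by
    rw [card_unitTorus]; push_cast; rfl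
  rw [hcard] at key
  unfold kingVacuumDensity
  rw [abs_div, abs_of_pos hT, div_le_iff₀ hT]
  calc _ ≤ _ := key
    _ = _ := by ring

/-- ★★★ **THE VACUUM ENERGY DENSITY OF A DIAGRAM CONVERGES AS `K → ∞`, WITH RATE AND BOUND INDEPENDENT OF THE VOLUME — THEOREM 2.1 (ii) (2.23)'s CONTENT
`|ln Z(T)| ≤ C|T|` FOR ONE DIAGRAM, BY NAME AT `A = 0`.**  For odd `L ≥ 3`, `a > 0`, `m₀² ≥ 0` there are `A ≥ 1`, `γ > 0` such that for every mass, EVERY volume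
exponent `e_M`, every CONNECTED vacuum graph under p. 664's sentence with King's degrees positive along every ordering ((3.77)): the density `e_K(G)` has a
limit `e_∞(G)` with `|e_K(G) − e_∞(G)| ≤ (L^{−γ}A^{2m+nn+1}m!(m+1))(L^{−γ})^K∕(1 − L^{−γ})` and `|e_∞(G)| ≤ A^{m+nn+1}·Σ_π degConst` — NO `|T|` ANYWHERE.
[cite: King1986, Thm 2.1 (2.22)–(2.23) p.654, (3.13) p.657, Thm 3.4 (3.9) p.656, (3.77) p.666] -/
theorem king_vacuum_density_continuumLimit (hLodd : Odd L) (hL : 2 ≤ L) {a : ℝ} (ha : 0 < a) {m0sq : ℝ} (hm0 : 0 ≤ m0sq) :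
    ∃ A γ : ℝ, 1 ≤ A ∧ 0 < γ ∧ ∀ (msq : ℝ), 0 < msq → msq ≤ m0sq → ∀ (eM nn m : ℕ) (src tgt : Fin m → Fin (nn + 1)), (∀ v, LConn src tgt univ 0 v) →
      ∀ (κ : Fin m → Option (Fin (d + 1))), PosSubgraphsBy src tgt 0 ((d + 1 : ℕ) : ℝ) (fun ℓ => lineExp (d + 1) (κ ℓ)) →
      (∀ π : Equiv.Perm (Fin m), PosDegrees (kingDegList src tgt ((d + 1 : ℕ) : ℝ) (fun ℓ => lineExp (d + 1) (κ ℓ)) π)) →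
      ∃ einf : ℝ, Tendsto (kingVacuumDensity L a msq eM nn m src tgt κ) atTop (𝓝 einf) ∧
        (∀ K : ℕ, |kingVacuumDensity L a msq eM nn m src tgt κ K - einf|
          ≤ ((L : ℝ) ^ (-γ) * (A ^ (2 * m + nn + 1) * ((m.factorial : ℝ) * (m + 1)))) * ((L : ℝ) ^ (-γ)) ^ K / (1 - (L : ℝ) ^ (-γ))) ∧
        |einf| ≤ A ^ (m + nn + 1) * ∑ π : Equiv.Perm (Fin m), degConst L (kingDegList src tgt ((d + 1 : ℕ) : ℝ) (fun ℓ => lineExp (d + 1) (κ ℓ)) π) := by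
  obtain ⟨A₁, γ, hA₁, hγ, H₁⟩ := kingVacuumDensity_succ_sub_le (d := d) L hLodd hL ha hm0
  obtain ⟨A₂, hA₂, H₂⟩ := kingVacuumDensity_abs_le (d := d) L hLodd hL ha hm0
  set A : ℝ := max A₁ A₂ with hAdef
  have hA : 1 ≤ A := hA₁.trans (le_max_left _ _)
  have hA0 : 0 ≤ A := zero_le_one.trans hA
  refine ⟨A, γ, hA, hγ, fun msq hm hcap eM nn m src tgt hconn κ hsub hking => ?_⟩
  have hL1r : (1 : ℝ) < L := by exact_mod_cast (show 1 < L by omega)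
  have hr0 : 0 ≤ (L : ℝ) ^ (-γ) := Real.rpow_nonneg (by linarith) _
  have hr1 : (L : ℝ) ^ (-γ) < 1 := Real.rpow_lt_one_of_one_lt_of_neg hL1r (by linarith)
  set C : ℝ := (L : ℝ) ^ (-γ) * (A ^ (2 * m + nn + 1) * ((m.factorial : ℝ) * (m + 1))) with hC
  have hdist : ∀ K, dist (kingVacuumDensity L a msq eM nn m src tgt κ K) (kingVacuumDensity L a msq eM nn m src tgt κ (K + 1)) ≤ C * ((L : ℝ) ^ (-γ)) ^ K :=
    fun K => by
    rw [Real.dist_eq, abs_sub_comm]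
    refine (H₁ msq hm hcap eM nn m src tgt hconn κ hsub K).trans (mul_le_mul_of_nonneg_right ?_ (pow_nonneg hr0 _))
    exact mul_le_mul_of_nonneg_left (mul_le_mul_of_nonneg_right
      (pow_le_pow_left₀ (zero_le_one.trans hA₁) (le_max_left _ _) _) (by positivity)) hr0
  obtain ⟨einf, hlim⟩ := cauchySeq_tendsto_of_complete (cauchySeq_of_le_geometric _ C hr1 hdist)
  have hdeg : 0 ≤ ∑ π : Equiv.Perm (Fin m), degConst L (kingDegList src tgt ((d + 1 : ℕ) : ℝ) (fun ℓ => lineExp (d + 1) (κ ℓ)) π) :=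
    sum_nonneg fun π _ => zero_le_one.trans (one_le_degConst L hL (hking π))
  refine ⟨einf, hlim, fun K => ?_, ?_⟩
  · rw [← Real.dist_eq]
    exact dist_le_of_le_geometric_of_tendsto _ C hr1 hdist hlim K
  · refine le_of_tendsto ((continuous_abs.tendsto einf).comp hlim) (Eventually.of_forall fun K => ?_)
    refine (H₂ msq hm hcap eM nn m src tgt hconn κ hking K).trans ?_
    exact mul_le_mul_of_nonneg_right (pow_le_pow_left₀ (zero_le_one.trans hA₂) (le_max_right _ _) _) hdeg

/-- ★★ **THE VACUUM ENERGY DENSITY OF EVERY CONNECTED PSEUDOFOREST OF `G`-LINES CONVERGES, VOLUME-FREE — NO HYPOTHESIS** (`1 ≤ d ≤ 3`).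
[cite: King1986, Thm 2.1 (2.22)–(2.23) p.654, (3.13) p.657, p.664, (3.77) p.666] -/
theorem king_vacuum_pseudoforest_density_continuumLimit (hd1 : 1 ≤ d) (hd3 : d ≤ 3) (hLodd : Odd L) (hL : 2 ≤ L) {a : ℝ} (ha : 0 < a)
    {m0sq : ℝ} (hm0 : 0 ≤ m0sq) :
    ∃ A γ : ℝ, 1 ≤ A ∧ 0 < γ ∧ ∀ (msq : ℝ), 0 < msq → msq ≤ m0sq → ∀ (eM nn m : ℕ) (src tgt : Fin m → Fin (nn + 1)), (∀ v, LConn src tgt univ 0 v) →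
      (∀ ℓ, src ℓ ≠ tgt ℓ) → (∀ S : Finset (Fin m), S.card ≤ (lineVerts src tgt S).card) →
      (∀ S : Finset (Fin m), S.card = 2 → 3 ≤ (lineVerts src tgt S).card) →
      ∃ einf : ℝ, Tendsto (kingVacuumDensity L a msq eM nn m src tgt (fun _ : Fin m => (none : Option (Fin (d + 1))))) atTop (𝓝 einf) ∧
        (∀ K : ℕ, |kingVacuumDensity L a msq eM nn m src tgt (fun _ : Fin m => (none : Option (Fin (d + 1)))) K - einf|
          ≤ ((L : ℝ) ^ (-γ) * (A ^ (2 * m + nn + 1) * ((m.factorial : ℝ) * (m + 1)))) * ((L : ℝ) ^ (-γ)) ^ K / (1 - (L : ℝ) ^ (-γ))) ∧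
        |einf| ≤ A ^ (m + nn + 1) * ∑ π : Equiv.Perm (Fin m), degConst L (kingDegList src tgt ((d + 1 : ℕ) : ℝ)
          (fun ℓ => lineExp (d + 1) ((fun _ : Fin m => (none : Option (Fin (d + 1)))) ℓ)) π) := by
  obtain ⟨A, γ, hA, hγ, H⟩ := king_vacuum_density_continuumLimit (d := d) L hLodd hL ha hm0
  refine ⟨A, γ, hA, hγ, fun msq hm hcap eM nn m src tgt hconn h1 h2 h3 => ?_⟩
  exact H msq hm hcap eM nn m src tgt hconn _ (posSubgraphsBy_lineExp_pseudoforest hd1 hd3 h1 h2 h3)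
    (posDegrees_kingDegList_pseudoforest hd1 hd3 h1 h2 h3)

end Density

end Summit.QuantumFields.YangMills.BalabanUVNodes.N15KingModelRung.Curved

end
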